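import Summits.AtomisticToContinuum.Crystallization.Theorems.FrustratedLawDichotomyStrainedPatchHomSlopeLJAffine2Fast

/-!
# The SECOND-ORDER CENTRED affine slope leaf of the pure LJ profile (K1-v2), FAST ARRAY: ★★★ soundness
# (27623 `(H) HomFloor (1/625)`, hcp half; hand-1 g34 FINDING §4)

decomp-a2c hand-1 g34 (crux `AperiodicFrustratedLawGap`, stmt-AtomisticToContinuum-27623).  ★★★ `slopeLJA2_bound_of_check` / `forceLJA2_ref_bound_of_check`:
the reference force bound along the affine reference from the second-order centred check `…HomSlopeLJAffine2Fast.slopeCheckLJA2F` (kernel-fast array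
`QarrLJA2F`; verbatim `…HomSlopeLJAffine2` with `mem_QarrLJA2F` in place of the label-loop membership) — the SAME conclusion as
`…HomSlopeLJAffine.forceLJA_ref_bound_of_check`, so the leaf `…HomEntryLeafHTA` takes it by swapping one chunk lemma.  Skeleton of
`…HomSlopeLJAffine.slopeLJA_bound_of_check`; new: the quadratic term is split `d = MD + s`, its `MD ⊗ MD` part re-summed over labels into the combined array
(`quad_expand`, `sum4_comm`), the `s`-cross terms and the third-order remainders bounded per label (`label_slope3_LJ_of_ok`).

NO definitions; 0 sorry; standard axioms; no instances / notation / `#eval`.  `--supports stmt-AtomisticToContinuum-27623`.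
-/

noncomputable section

namespace Summit.AtomisticToContinuum.Crystallization.Theorems.FrustratedLawDichotomyStrainedPatchHomSlopeLJAffine2F

open scoped BigOperators RealInnerProductSpace
open Literature.Analysis.ValidatedNumerics.Numerics
open Literature.Analysis.ValidatedNumerics.IntervalGershgorin (lsum)
open Summit.AtomisticToContinuum.Crystallization.Theorems.ChargedEnergyGapNegative (E3)
open Summit.AtomisticToContinuum.Crystallization.Theorems.FrustratedLawDichotomyStrainedPatchHomSplit (latPt hexFrame hcpShift)
open Summit.AtomisticToContinuum.Crystallization.Theorems.FrustratedLawDichotomyStrainedPatchHomCoords (apply_eq_sum_entries)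
open Summit.AtomisticToContinuum.Crystallization.Theorems.FrustratedLawDichotomyStrainedPatchHomEntryGram (entryFI mem_entryFI)
open Summit.AtomisticToContinuum.Crystallization.Theorems.FrustratedLawDichotomyStrainedPatchHomEntryGramHcp (dot3 shufFI mem_dot3 mem_shufFI)
open Summit.AtomisticToContinuum.Crystallization.Theorems.FrustratedLawDichotomyStrainedPatchHomForceKit (vecB mem_vecB phiFI)
open Summit.AtomisticToContinuum.Crystallization.Theorems.FrustratedLawDichotomyStrainedPatchHomCurvKit (accFI mem_accFI)
open Summit.AtomisticToContinuum.Crystallization.Theorems.FrustratedLawDichotomyStrainedPatchHomConvexCurvature (segG_zero_eq inner_eq_sum3)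
open Summit.AtomisticToContinuum.Crystallization.Theorems.FrustratedLawDichotomyStrainedPatchHomCurvCentre (pert_rearrange pert_abs_le)
open Summit.AtomisticToContinuum.Crystallization.Theorems.FrustratedLawDichotomyStrainedPatchHomCurvCentreKit
open Summit.AtomisticToContinuum.Crystallization.Theorems.FrustratedLawDichotomyStrainedPatchHomCurvRegime3
open Summit.AtomisticToContinuum.Crystallization.Theorems.FrustratedLawDichotomyStrainedPatchHomCurvLeafL (dflt3)
open Summit.AtomisticToContinuum.Crystallization.Theorems.FrustratedLawDichotomyStrainedPatchHomCurvCoeff3 (ljTripleFI mem_ljTripleFI)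
open Summit.AtomisticToContinuum.Crystallization.Theorems.FrustratedLawDichotomyStrainedPatchHomSlopeLeafC (abs_sum_mul_le_sqrtHi H0r linSlope_eq)
open Summit.AtomisticToContinuum.Crystallization.Theorems.FrustratedLawDichotomyStrainedPatchHomCurvLJ
  (betaLJ_eq_profile A0lj B0lj A1qlj a1qLJ ttLJ t0LJ Q0 KSlj recLJ ljLabelOK naiveLJ mem_naiveLJ)
open Summit.AtomisticToContinuum.Crystallization.Theorems.FrustratedLawDichotomyStrainedPatchHomSlopeLJ
open Summit.AtomisticToContinuum.Crystallization.Theorems.FrustratedLawDichotomyStrainedPatchHomSlopeLJAffine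
open Summit.AtomisticToContinuum.Crystallization.Theorems.FrustratedLawDichotomyStrainedPatchHomSlopeLJThird
open Summit.AtomisticToContinuum.Crystallization.Theorems.FrustratedLawDichotomyStrainedPatchHomForceRing (segG_ljProfile_zero)
open Summit.AtomisticToContinuum.Crystallization.Theorems.FrustratedLawDichotomyStrainedPatchTaylorChord (segR segG)
open Summit.AtomisticToContinuum.Crystallization.Theorems.FrustratedLawDichotomyStrainedPatchHomLatticeBoxHcp (norm_shifted_gt)

open Summit.AtomisticToContinuum.Crystallization.Theorems.FrustratedLawDichotomyStrainedPatchHomSlopeLJAffine2Kit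

/-! ## §3. ★★★ Soundness -/

/-- ★★★ **SOUNDNESS OF THE SECOND-ORDER CENTRED AFFINE LJ SLOPE LEAF** (segment-slope form, reference shuffle `ξ₀ = affShuf J c U`). [folklore chaining;
skeleton of `…HomSlopeLJAffine.slopeLJA_bound_of_check` with the per-label third-order estimate and the combined quadratic term] -/
theorem slopeLJA2F_bound_of_check {c w : (Fin 3 × Fin 3) ⊕ Fin 3 → ℤ} {J : Fin 3 → Fin 3 × Fin 3 → ℤ} {Lc Ln : List (Fin 3 → ℤ)} (hL : (Lc ++ Ln).Nodup)
    {Gs : ℤ} (h : slopeCheckLJA2F c w J Lc Ln Gs = true) (U : E3 →L[ℝ] E3) (hU : ‖U - 1‖ ≤ 1 / 4)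
    (hbox : ∀ ab : Fin 3 × Fin 3, |(U (EuclideanSpace.single ab.2 (1 : ℝ))) ab.1 - (c (Sum.inl ab) : ℝ) / SC| ≤ (w (Sum.inl ab) : ℝ) / SC)
    (hn₀ : ‖affShuf J c U‖ ≤ 1 / 4) (ξ : E3) :
    |∑ b ∈ (Lc ++ Ln).toFinset, segG (fun x : ℝ => x⁻¹ ^ 7 - x⁻¹ ^ 13) (latPt U hexFrame b + U (hcpShift + affShuf J c U)) (U (ξ - affShuf J c U)) 0| ≤
      (Gs : ℝ) / SC * ‖U (ξ - affShuf J c U)‖ := by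
  classical
  have hS : (0 : ℝ) < SC := by norm_num [SC]
  unfold slopeCheckLJA2F at h
  simp only [Bool.and_eq_true, List.all_eq_true, decide_eq_true_eq] at h
  obtain ⟨⟨hcen, hnai⟩, hsum⟩ := h
  obtain ⟨hLc, hLn, hdisj⟩ := List.nodup_append.1 hL
  have hdisj' : List.Disjoint Lc Ln := fun a ha hb => hdisj a ha a hb rfl
  set ξ₀ : E3 := affShuf J c U with hξ₀def
  set w' : (Fin 3 × Fin 3) ⊕ Fin 3 → ℤ := hullW J w with hw'
  have hbox' : ∀ ab : Fin 3 × Fin 3, |(U (EuclideanSpace.single ab.2 (1 : ℝ))) ab.1 - (c (Sum.inl ab) : ℝ) / SC| ≤ (w' (Sum.inl ab) : ℝ) / SC := hbox_hull U hbox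
  have hξ₀ : ∀ i : Fin 3, |ξ₀ i - (c (Sum.inr i) : ℝ) / SC| ≤ (w' (Sum.inr i) : ℝ) / SC := fun i => affShuf_mem_hull U hbox i
  set Δ : E3 := U (ξ - ξ₀) with hΔ
  set cb : (Fin 3 → ℤ) → E3 := fun b => latPt U hexFrame b + U (hcpShift + ξ₀) with hcb
  have hρpos : ∀ b : Fin 3 → ℤ, 0 < ‖cb b‖ := fun b => lt_trans (by norm_num) (norm_shifted_gt hU hn₀ b)
  have hsummand : ∀ b ∈ (Lc ++ Ln).toFinset, segG (fun x : ℝ => x⁻¹ ^ 7 - x⁻¹ ^ 13) (cb b) Δ 0 = betaLJ ‖cb b‖ * ⟪cb b, Δ⟫ :=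
    fun b _ => by rw [segG_zero_eq, betaLJ_eq_profile (hρpos b).ne']
  rw [Finset.sum_congr rfl hsummand, List.toFinset_append, Finset.sum_union (List.disjoint_toFinset_iff_disjoint.2 hdisj')]
  -- NAIVE part (hull box)
  have hCn : ∀ (b : Fin 3 → ℤ) (a : Fin 3), FI.mem (cb b a) (vecB (boxE c w') (shufFI c w') b a) := mem_vecB U ξ₀ (mem_entryFI <| hbox' ·) (mem_shufFI <| hξ₀ ·)
  have hQn : ∀ b : Fin 3 → ℤ, FI.mem (‖cb b‖ ^ 2) (dot3 (vecB (boxE c w') (shufFI c w') b) (vecB (boxE c w') (shufFI c w') b)) := by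
    intro b; rw [← real_inner_self_eq_norm_sq]; exact mem_dot3 (hCn b) (hCn b)
  have hβn : ∀ b ∈ Ln, FI.mem (betaLJ ‖cb b‖) ((naiveLJ c w' b).getD (FI.ofInt 0, FI.ofInt 0)).2 := by
    intro b hb
    obtain ⟨AB, hAB⟩ := Option.isSome_iff_exists.1 (hnai b hb)
    have := (mem_naiveLJ hAB (hQn b)).2; rw [hAB]; simpa using this
  have hNai : |∑ b ∈ Ln.toFinset, betaLJ ‖cb b‖ * ⟪cb b, Δ⟫| ≤ (naiSLJ c w' Ln : ℝ) / SC * ‖Δ‖ := by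
    have hre : ∑ b ∈ Ln.toFinset, betaLJ ‖cb b‖ * ⟪cb b, Δ⟫ = ∑ i, (∑ b ∈ Ln.toFinset, betaLJ ‖cb b‖ * cb b i) * Δ i := by
      calc ∑ b ∈ Ln.toFinset, betaLJ ‖cb b‖ * ⟪cb b, Δ⟫ = ∑ b ∈ Ln.toFinset, ∑ i, betaLJ ‖cb b‖ * cb b i * Δ i :=
            Finset.sum_congr rfl fun b _ => by rw [inner_eq_sum3, Finset.mul_sum]; exact Finset.sum_congr rfl fun i _ => by ring
        _ = ∑ i, ∑ b ∈ Ln.toFinset, betaLJ ‖cb b‖ * cb b i * Δ i := Finset.sum_comm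
        _ = ∑ i, (∑ b ∈ Ln.toFinset, betaLJ ‖cb b‖ * cb b i) * Δ i := Finset.sum_congr rfl fun i _ => by rw [Finset.sum_mul]
    rw [hre]
    exact abs_sum_mul_le_sqrtHi _ Δ (fun i => (GnLJ c w' Ln i).absHi) fun i => FI.abs_le_absHi (mem_accFI Ln hLn fun b hb => FI.mem_mul (hβn b hb) (hCn b i))
  -- CENTRED part: per-label third-order estimate on the hull box
  have hlf := fun b (hb : b ∈ Lc) => label_slope3_LJ_of_ok (hcen b hb) U hbox' ξ₀ hξ₀ Δ
  set pc : (Fin 3 → ℤ) → E3 := fun b => cenPt c b with hpc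
  set αb : (Fin 3 → ℤ) → ℝ := fun b => alphaLJ ‖pc b‖ with hαb
  set βb : (Fin 3 → ℤ) → ℝ := fun b => betaLJ ‖pc b‖ with hβb
  set ab1 : (Fin 3 → ℤ) → ℝ := fun b => alpha1LJ ‖pc b‖ / ‖pc b‖ with hab1
  have hG0 : |∑ b ∈ Lc.toFinset, βb b * ⟪pc b, Δ⟫| ≤ (g0LJ c Lc : ℝ) / SC * ‖Δ‖ := by
    have hre : ∑ b ∈ Lc.toFinset, βb b * ⟪pc b, Δ⟫ = ∑ i, (∑ b ∈ Lc.toFinset, βb b * pc b i) * Δ i := by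
      calc ∑ b ∈ Lc.toFinset, βb b * ⟪pc b, Δ⟫ = ∑ b ∈ Lc.toFinset, ∑ i, βb b * pc b i * Δ i :=
            Finset.sum_congr rfl fun b _ => by rw [inner_eq_sum3, Finset.mul_sum]; exact Finset.sum_congr rfl fun i _ => by ring
        _ = ∑ i, ∑ b ∈ Lc.toFinset, βb b * pc b i * Δ i := Finset.sum_comm
        _ = ∑ i, (∑ b ∈ Lc.toFinset, βb b * pc b i) * Δ i := Finset.sum_congr rfl fun i _ => by rw [Finset.sum_mul]
    rw [hre]
    exact abs_sum_mul_le_sqrtHi _ Δ (fun i => (G0LJ c Lc i).absHi) fun i => FI.abs_le_absHi (mem_accFI Lc hLc fun b hb => FI.mem_mul (hlf b hb).2.1 (mem_cenVec c b i))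
  -- displacement structure: `d_b,k = Σ_a M_b,k,a D_a + s_k`
  set Dv : Fin 3 × Fin 3 → ℝ := fun a => (U (EuclideanSpace.single a.2 (1 : ℝ))) a.1 - (c (Sum.inl a) : ℝ) / SC with hDv
  have hDvabs : ∀ a, |Dv a| ≤ (w (Sum.inl a) : ℝ) / SC := fun a => hbox a
  choose s hs using fun k => shift_affine_decomp (J := J) (c := c) (w := w) U hbox k
  have hdm : ∀ (b : Fin 3 → ℤ) (k : Fin 3), (cb b - pc b) k = (∑ a : Fin 3 × Fin 3, Mre c J b k a * Dv a) + s k := by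
    intro b k
    rw [dVec_formula c U ξ₀ b k, (hs k).1, sum_Mre_eq]
    simp only [hDv]
    ring
  have hmabs : ∀ (b : Fin 3 → ℤ) (k : Fin 3), |∑ a : Fin 3 × Fin 3, Mre c J b k a * Dv a| ≤ (mDb c w J b k : ℝ) / SC := by
    intro b k
    have h1 : |∑ a : Fin 3 × Fin 3, Mre c J b k a * Dv a| ≤ ∑ a : Fin 3 × Fin 3, ((MfiA c J b k a).absHi : ℝ) / SC * ((w (Sum.inl a) : ℝ) / SC) := by
      refine (Finset.abs_sum_le_sum_abs _ _).trans (Finset.sum_le_sum fun a _ => ?_)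
      rw [abs_mul]
      have hA : |Mre c J b k a| ≤ ((MfiA c J b k a).absHi : ℝ) / SC := by rw [le_div_iff₀ hS]; exact FI.abs_le_absHi (mem_MfiA c J b k a)
      exact mul_le_mul hA (hDvabs a) (abs_nonneg _) ((abs_nonneg _).trans hA)
    refine h1.trans ?_
    have hcd := div_le_cdiv (a := ∑ a : Fin 3 × Fin 3, (MfiA c J b k a).absHi * w (Sum.inl a)) (b := (SC : ℤ)) (by exact_mod_cast hS)
    have e : ∑ a : Fin 3 × Fin 3, ((MfiA c J b k a).absHi : ℝ) / SC * ((w (Sum.inl a) : ℝ) / SC) =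
        ((∑ a : Fin 3 × Fin 3, (MfiA c J b k a).absHi * w (Sum.inl a) : ℤ) : ℝ) / (SC : ℤ) / SC := by
      push_cast; rw [Finset.sum_div, Finset.sum_div]; exact Finset.sum_congr rfl fun a _ => by ring
    rw [e, mDb]
    exact div_le_div_of_nonneg_right (by exact_mod_cast hcd) hS.le
  have hsabs : ∀ k, |s k| ≤ (ubA J w k : ℝ) / SC := fun k => by rw [le_div_iff₀ hS]; exact (hs k).2
  -- ★ the first-order term (verbatim `…HomSlopeLJAffine`)
  set X : Fin 3 → ℝ := fun i => ∑ b ∈ Lc.toFinset, ∑ k, (cb b - pc b) k * H0r (αb b) (βb b) (pc b) k i with hX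
  have hlin_eq : ∑ b ∈ Lc.toFinset, (αb b * ⟪pc b, cb b - pc b⟫ * ⟪pc b, Δ⟫ + βb b * ⟪cb b - pc b, Δ⟫) = ∑ i, X i * Δ i := by
    rw [Finset.sum_congr rfl fun b _ => linSlope_eq (pc b) (cb b - pc b) Δ (αb b) (βb b), Finset.sum_comm]
    refine Finset.sum_congr rfl fun i _ => ?_
    rw [hX, Finset.sum_mul]
  have hXb : ∀ i, |X i| * SC ≤ (VvecLJA c w J Lc i : ℝ) := by
    intro i
    set Hb : (Fin 3 → ℤ) → Fin 3 → ℝ := fun b k => H0r (αb b) (βb b) (pc b) k i with hHb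
    set dU : Fin 3 → Fin 3 → ℝ := fun k l => (U (EuclideanSpace.single l (1 : ℝ))) k - (c (Sum.inl (k, l)) : ℝ) / SC with hdU
    have hd : ∀ (b : Fin 3 → ℤ) (k : Fin 3), (cb b - pc b) k = ∑ l : Fin 3, dU k l * wPt c b l + (U (ξ₀ - cenShuf c)) k :=
      fun b k => dVec_formula c U ξ₀ b k
    have hre0 : X i = ∑ k, ∑ l, dU k l * (∑ b ∈ Lc.toFinset, wPt c b l * Hb b k) + ∑ k, (U (ξ₀ - cenShuf c)) k * ∑ b ∈ Lc.toFinset, Hb b k := by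
      rw [hX]
      simp only []
      rw [Finset.sum_congr rfl fun b _ => Finset.sum_congr rfl fun k _ => by rw [hd b k]]
      exact pert_rearrange Lc.toFinset dU (fun k => (U (ξ₀ - cenShuf c)) k) (fun b l => wPt c b l) Hb
    have hx : ∀ k, (U (ξ₀ - cenShuf c)) k = ∑ k' : Fin 3, ∑ l : Fin 3, dU k' l * cJr c J k (k', l) + s k := fun k => (hs k).1
    set G : Fin 3 → Fin 3 → ℝ := fun k l => ∑ b ∈ Lc.toFinset, (wPt c b l * Hb b k + ∑ k'' : Fin 3, cJr c J k'' (k, l) * Hb b k'') with hG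
    have hGsplit : ∀ k l, G k l = (∑ b ∈ Lc.toFinset, wPt c b l * Hb b k) + ∑ k'' : Fin 3, cJr c J k'' (k, l) * ∑ b ∈ Lc.toFinset, Hb b k'' := by
      intro k l
      rw [hG]
      simp only []
      rw [Finset.sum_add_distrib]
      congr 1
      rw [Finset.sum_comm]
      exact Finset.sum_congr rfl fun k'' _ => by rw [Finset.mul_sum]
    have hre1 : ∑ k, (U (ξ₀ - cenShuf c)) k * ∑ b ∈ Lc.toFinset, Hb b k =
        ∑ k, (∑ k' : Fin 3, ∑ l : Fin 3, dU k' l * cJr c J k (k', l) + s k) * ∑ b ∈ Lc.toFinset, Hb b k :=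
      Finset.sum_congr rfl fun k _ => by rw [hx k]
    have hre : X i = ∑ k, ∑ l, dU k l * G k l + ∑ k, s k * ∑ b ∈ Lc.toFinset, Hb b k := by
      rw [hre0, hre1]
      rw [aff_rearrange dU (fun k l => ∑ b ∈ Lc.toFinset, wPt c b l * Hb b k) (fun k ab => cJr c J k ab) s (fun k => ∑ b ∈ Lc.toFinset, Hb b k)]
      congr 1
      exact Finset.sum_congr rfl fun k _ => Finset.sum_congr rfl fun l _ => by rw [hGsplit k l]
    have hM : ∀ k l, FI.mem (G k l) (MarrLJA c J Lc k l i) := by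
      intro k l
      refine mem_accFI Lc hLc fun b hb => ?_
      refine FI.mem_add ?_ ?_
      · rw [mul_comm]; exact FI.mem_mul (mem_H0LJ (hlf b hb).1 (hlf b hb).2.1 k i) (mem_wVec c b l)
      · rw [Fin.sum_univ_three]
        exact FI.mem_add (FI.mem_add (FI.mem_mul (mem_cJ c J 0 (k, l)) (mem_H0LJ (hlf b hb).1 (hlf b hb).2.1 0 i))
          (FI.mem_mul (mem_cJ c J 1 (k, l)) (mem_H0LJ (hlf b hb).1 (hlf b hb).2.1 1 i)))
          (FI.mem_mul (mem_cJ c J 2 (k, l)) (mem_H0LJ (hlf b hb).1 (hlf b hb).2.1 2 i))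
    have hN : ∀ k, FI.mem (∑ b ∈ Lc.toFinset, Hb b k) (NarrLJ c Lc k i) := fun k =>
      mem_accFI Lc hLc fun b hb => mem_H0LJ (hlf b hb).1 (hlf b hb).2.1 k i
    have habs := pert_abs_le dU G (fun k l => (w (Sum.inl (k, l)) : ℝ) / SC) (fun k l => ((MarrLJA c J Lc k l i).absHi : ℝ) / SC) s
      (fun k => ∑ b ∈ Lc.toFinset, Hb b k) (fun k => (ubA J w k : ℝ) / SC) (fun k => ((NarrLJ c Lc k i).absHi : ℝ) / SC)
      (fun k l => hbox (k, l)) (fun k l => by rw [le_div_iff₀ hS]; exact FI.abs_le_absHi (hM k l))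
      (fun k => by rw [le_div_iff₀ hS]; exact (hs k).2) (fun k => by rw [le_div_iff₀ hS]; exact FI.abs_le_absHi (hN k))
    rw [← hre] at habs
    have hsum' : (∑ k : Fin 3, ∑ l : Fin 3, (w (Sum.inl (k, l)) : ℝ) / SC * (((MarrLJA c J Lc k l i).absHi : ℝ) / SC) +
        ∑ k : Fin 3, (ubA J w k : ℝ) / SC * (((NarrLJ c Lc k i).absHi : ℝ) / SC)) * SC =
        ((∑ k : Fin 3, ∑ l : Fin 3, w (Sum.inl (k, l)) * (MarrLJA c J Lc k l i).absHi + ∑ k : Fin 3, ubA J w k * (NarrLJ c Lc k i).absHi : ℤ) : ℝ) / SC := by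
      push_cast
      rw [eq_div_iff hS.ne']
      simp only [add_mul, Finset.sum_mul]
      congr 1
      · exact Finset.sum_congr rfl fun k _ => Finset.sum_congr rfl fun l _ => by field_simp
      · exact Finset.sum_congr rfl fun k _ => by field_simp
    have hcd := div_le_cdiv (a := ∑ k : Fin 3, ∑ l : Fin 3, w (Sum.inl (k, l)) * (MarrLJA c J Lc k l i).absHi +
      ∑ k : Fin 3, ubA J w k * (NarrLJ c Lc k i).absHi) (b := (SC : ℤ)) (by exact_mod_cast hS)
    calc |X i| * SC ≤ _ := mul_le_mul_of_nonneg_right habs hS.le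
      _ = _ := hsum'
      _ ≤ (VvecLJA c w J Lc i : ℝ) := by rw [VvecLJA]; exact_mod_cast hcd
  have hLin : |∑ i, X i * Δ i| ≤ (linLJA c w J Lc : ℝ) / SC * ‖Δ‖ := abs_sum_mul_le_sqrtHi X Δ (fun i => VvecLJA c w J Lc i) hXb
  -- ★★ the quadratic term, combined across labels
  set Tb : (Fin 3 → ℤ) → Fin 3 → Fin 3 → Fin 3 → ℝ := fun b k k' i => Dreal (ab1 b) (αb b) (pc b) k k' i with hTb
  set Z : Fin 3 → ℝ := fun i => (∑ b ∈ Lc.toFinset, ∑ k : Fin 3, ∑ k' : Fin 3, Tb b k k' i * ((cb b - pc b) k * (cb b - pc b) k')) / 2 with hZ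
  have hquad_eq : ∑ b ∈ Lc.toFinset, ((ab1 b * ⟪pc b, cb b - pc b⟫ ^ 2 + αb b * ‖cb b - pc b‖ ^ 2) * ⟪pc b, Δ⟫ +
      2 * αb b * ⟪pc b, cb b - pc b⟫ * ⟪cb b - pc b, Δ⟫) / 2 = ∑ i, Z i * Δ i := by
    rw [Finset.sum_congr rfl fun b _ => by rw [quadSlope_eq (pc b) (cb b - pc b) Δ (ab1 b) (αb b)]]
    rw [← Finset.sum_div, Finset.sum_comm, Finset.sum_div]
    refine Finset.sum_congr rfl fun i _ => ?_
    rw [hZ, ← Finset.sum_mul]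
    simp only [hTb]
    ring
  have hZb : ∀ i, |Z i| * SC ≤ (quadVec2F c w J Lc i : ℝ) := by
    intro i
    -- split `d = m + s`
    set m : (Fin 3 → ℤ) → Fin 3 → ℝ := fun b k => ∑ a : Fin 3 × Fin 3, Mre c J b k a * Dv a with hm
    have hsplit : ∑ b ∈ Lc.toFinset, ∑ k : Fin 3, ∑ k' : Fin 3, Tb b k k' i * ((cb b - pc b) k * (cb b - pc b) k') =
        ∑ b ∈ Lc.toFinset, ∑ k : Fin 3, ∑ k' : Fin 3, Tb b k k' i * (m b k * m b k') +
        ∑ b ∈ Lc.toFinset, ∑ k : Fin 3, ∑ k' : Fin 3, Tb b k k' i * (m b k * s k' + s k * m b k' + s k * s k') := by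
      rw [← Finset.sum_add_distrib]
      refine Finset.sum_congr rfl fun b _ => ?_
      rw [← Finset.sum_add_distrib]
      refine Finset.sum_congr rfl fun k _ => ?_
      rw [← Finset.sum_add_distrib]
      exact Finset.sum_congr rfl fun k' _ => by rw [hdm b k, hdm b k']; simp only [hm]; ring
    -- main part as the combined quadratic form
    set Qre : Fin 3 × Fin 3 → Fin 3 × Fin 3 → ℝ := fun a a' => ∑ b ∈ Lc.toFinset, ∑ k : Fin 3, ∑ k' : Fin 3, Mre c J b k a * Mre c J b k' a' * Tb b k k' i with hQre
    have hmain_eq : ∑ b ∈ Lc.toFinset, ∑ k : Fin 3, ∑ k' : Fin 3, Tb b k k' i * (m b k * m b k') =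
        ∑ a : Fin 3 × Fin 3, ∑ a' : Fin 3 × Fin 3, Dv a * Dv a' * Qre a a' := by
      rw [Finset.sum_congr rfl fun b _ => quad_expand (fun k k' => Tb b k k' i) (fun k a => Mre c J b k a) Dv]
      rw [Finset.sum_comm]
      refine Finset.sum_congr rfl fun a _ => ?_
      rw [Finset.sum_comm]
      refine Finset.sum_congr rfl fun a' _ => ?_
      rw [hQre, Finset.mul_sum]
    have hQmem : ∀ a a', FI.mem (Qre a a') (QarrLJA2F c w J Lc i a a') := fun a a' =>
      mem_QarrLJA2F hLc (T := fun b k k' => Tb b k k' i)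
        (fun b hb k k' => mem_Darr (L := recLJ c w' b) (hlf b hb).2.2.1 (hlf b hb).1 (fun a => mem_cenVec c b a) k k' i) a a'
    have hmain : |∑ a : Fin 3 × Fin 3, ∑ a' : Fin 3 × Fin 3, Dv a * Dv a' * Qre a a'| ≤
        ∑ a : Fin 3 × Fin 3, ∑ a' : Fin 3 × Fin 3, (w (Sum.inl a) : ℝ) / SC * ((w (Sum.inl a') : ℝ) / SC) * (((QarrLJA2F c w J Lc i a a').absHi : ℝ) / SC) := by
      refine (Finset.abs_sum_le_sum_abs _ _).trans (Finset.sum_le_sum fun a _ => ?_)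
      refine (Finset.abs_sum_le_sum_abs _ _).trans (Finset.sum_le_sum fun a' _ => ?_)
      rw [abs_mul, abs_mul]
      have hq : |Qre a a'| ≤ ((QarrLJA2F c w J Lc i a a').absHi : ℝ) / SC := by rw [le_div_iff₀ hS]; exact FI.abs_le_absHi (hQmem a a')
      exact mul_le_mul (mul_le_mul (hDvabs a) (hDvabs a') (abs_nonneg _) ((abs_nonneg _).trans (hDvabs a))) hq (abs_nonneg _)
        (mul_nonneg ((abs_nonneg _).trans (hDvabs a)) ((abs_nonneg _).trans (hDvabs a')))
    -- residual part
    have hres : |∑ b ∈ Lc.toFinset, ∑ k : Fin 3, ∑ k' : Fin 3, Tb b k k' i * (m b k * s k' + s k * m b k' + s k * s k')| ≤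
        ∑ b ∈ Lc.toFinset, ∑ k : Fin 3, ∑ k' : Fin 3, (((Darr (recLJ c w' b) k k' i).absHi : ℝ) / SC) *
          ((mDb c w J b k : ℝ) / SC * ((ubA J w k' : ℝ) / SC) + (ubA J w k : ℝ) / SC * ((mDb c w J b k' : ℝ) / SC) +
            (ubA J w k : ℝ) / SC * ((ubA J w k' : ℝ) / SC)) := by
      refine (Finset.abs_sum_le_sum_abs _ _).trans (Finset.sum_le_sum fun b hb => ?_)
      have hb' := List.mem_toFinset.1 hb
      refine (Finset.abs_sum_le_sum_abs _ _).trans (Finset.sum_le_sum fun k _ => ?_)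
      refine (Finset.abs_sum_le_sum_abs _ _).trans (Finset.sum_le_sum fun k' _ => ?_)
      rw [abs_mul]
      have hT : |Tb b k k' i| ≤ ((Darr (recLJ c w' b) k k' i).absHi : ℝ) / SC := by
        rw [le_div_iff₀ hS]
        exact FI.abs_le_absHi (mem_Darr (L := recLJ c w' b) (hlf b hb').2.2.1 (hlf b hb').1 (fun a => mem_cenVec c b a) k k' i)
      have hm0 : ∀ k, (0 : ℝ) ≤ (mDb c w J b k : ℝ) / SC := fun k => (abs_nonneg _).trans (hmabs b k)
      have hs0 : ∀ k, (0 : ℝ) ≤ (ubA J w k : ℝ) / SC := fun k => (abs_nonneg _).trans (hsabs k)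
      refine mul_le_mul hT ?_ (abs_nonneg _) ((abs_nonneg _).trans hT)
      calc |m b k * s k' + s k * m b k' + s k * s k'| ≤ |m b k * s k'| + |s k * m b k'| + |s k * s k'| := abs_add_three _ _ _
        _ ≤ _ := by
          rw [abs_mul, abs_mul, abs_mul]
          exact add_le_add (add_le_add (mul_le_mul (hmabs b k) (hsabs k') (abs_nonneg _) (hm0 k))
            (mul_le_mul (hsabs k) (hmabs b k') (abs_nonneg _) (hs0 k))) (mul_le_mul (hsabs k) (hsabs k') (abs_nonneg _) (hs0 k))
    -- integer bookkeeping
    have hmainI : (∑ a : Fin 3 × Fin 3, ∑ a' : Fin 3 × Fin 3, (w (Sum.inl a) : ℝ) / SC * ((w (Sum.inl a') : ℝ) / SC) *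
        (((QarrLJA2F c w J Lc i a a').absHi : ℝ) / SC)) * SC * SC ≤
        ((∑ a : Fin 3 × Fin 3, ∑ a' : Fin 3 × Fin 3, cdiv (w (Sum.inl a) * w (Sum.inl a')) SC * (QarrLJA2F c w J Lc i a a').absHi : ℤ) : ℝ) := by
      push_cast
      rw [Finset.sum_mul, Finset.sum_mul]
      refine Finset.sum_le_sum fun a _ => ?_
      rw [Finset.sum_mul, Finset.sum_mul]
      refine Finset.sum_le_sum fun a' _ => ?_
      have hcd := div_le_cdiv (a := w (Sum.inl a) * w (Sum.inl a')) (b := (SC : ℤ)) (by exact_mod_cast hS)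
      have hA0 : (0 : ℝ) ≤ ((QarrLJA2F c w J Lc i a a').absHi : ℝ) := by
        have := FI.abs_le_absHi (hQmem a a'); exact le_trans (by positivity) this
      have e : (w (Sum.inl a) : ℝ) / SC * ((w (Sum.inl a') : ℝ) / SC) * (((QarrLJA2F c w J Lc i a a').absHi : ℝ) / SC) * SC * SC =
          ((w (Sum.inl a) * w (Sum.inl a') : ℤ) : ℝ) / (SC : ℤ) * ((QarrLJA2F c w J Lc i a a').absHi : ℝ) := by
        push_cast; field_simp
      rw [e]
      exact mul_le_mul_of_nonneg_right (by exact_mod_cast hcd) hA0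
    have hresI : (∑ b ∈ Lc.toFinset, ∑ k : Fin 3, ∑ k' : Fin 3, (((Darr (recLJ c w' b) k k' i).absHi : ℝ) / SC) *
          ((mDb c w J b k : ℝ) / SC * ((ubA J w k' : ℝ) / SC) + (ubA J w k : ℝ) / SC * ((mDb c w J b k' : ℝ) / SC) +
            (ubA J w k : ℝ) / SC * ((ubA J w k' : ℝ) / SC))) * SC * SC ≤ (resQ c w J Lc i : ℝ) := by
      rw [resQ, Int.cast_list_sum, List.map_map, ← List.sum_toFinset _ hLc, Finset.sum_mul, Finset.sum_mul]
      refine Finset.sum_le_sum fun b _ => ?_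
      simp only [Function.comp_apply]
      push_cast
      rw [Finset.sum_mul, Finset.sum_mul]
      refine Finset.sum_le_sum fun k _ => ?_
      rw [Finset.sum_mul, Finset.sum_mul]
      refine Finset.sum_le_sum fun k' _ => ?_
      have hcd := div_le_cdiv (a := (mDb c w J b k * ubA J w k' + ubA J w k * mDb c w J b k' + ubA J w k * ubA J w k') *
        (Darr (recLJ c w' b) k k' i).absHi) (b := (SC : ℤ)) (by exact_mod_cast hS)
      push_cast at hcd
      have e : (((Darr (recLJ c w' b) k k' i).absHi : ℝ) / SC) *
          ((mDb c w J b k : ℝ) / SC * ((ubA J w k' : ℝ) / SC) + (ubA J w k : ℝ) / SC * ((mDb c w J b k' : ℝ) / SC) +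
            (ubA J w k : ℝ) / SC * ((ubA J w k' : ℝ) / SC)) * SC * SC =
          ((mDb c w J b k : ℝ) * (ubA J w k') + (ubA J w k) * (mDb c w J b k') + (ubA J w k) * (ubA J w k')) *
            ((Darr (recLJ c w' b) k k' i).absHi : ℝ) / SC := by
        field_simp
      rw [e]
      exact hcd
    have hZi : |Z i| * SC ≤ ((∑ a : Fin 3 × Fin 3, ∑ a' : Fin 3 × Fin 3, cdiv (w (Sum.inl a) * w (Sum.inl a')) SC * (QarrLJA2F c w J Lc i a a').absHi +
        resQ c w J Lc i : ℤ) : ℝ) / (2 * SC) := by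
      rw [hZ]
      simp only []
      rw [hsplit, hmain_eq, abs_div, abs_of_pos (by norm_num : (0:ℝ) < 2)]
      have hsum2 := (abs_add_le _ _).trans (add_le_add hmain hres)
      rw [le_div_iff₀ (by positivity : (0:ℝ) < 2 * SC)]
      push_cast
      have e : |∑ a : Fin 3 × Fin 3, ∑ a' : Fin 3 × Fin 3, Dv a * Dv a' * Qre a a' +
            ∑ b ∈ Lc.toFinset, ∑ k : Fin 3, ∑ k' : Fin 3, Tb b k k' i * (m b k * s k' + s k * m b k' + s k * s k')| / 2 * SC * (2 * SC) =
          |∑ a : Fin 3 × Fin 3, ∑ a' : Fin 3 × Fin 3, Dv a * Dv a' * Qre a a' +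
            ∑ b ∈ Lc.toFinset, ∑ k : Fin 3, ∑ k' : Fin 3, Tb b k k' i * (m b k * s k' + s k * m b k' + s k * s k')| * SC * SC := by ring
      rw [e]
      have := mul_le_mul_of_nonneg_right (mul_le_mul_of_nonneg_right hsum2 hS.le) hS.le
      refine this.trans ?_
      rw [add_mul, add_mul]
      push_cast at hmainI hresI
      linarith [hmainI, hresI]
    refine hZi.trans ?_
    have hcd := div_le_cdiv (a := ∑ a : Fin 3 × Fin 3, ∑ a' : Fin 3 × Fin 3, cdiv (w (Sum.inl a) * w (Sum.inl a')) SC * (QarrLJA2F c w J Lc i a a').absHi +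
        resQ c w J Lc i) (b := 2 * (SC : ℤ)) (by norm_num [SC])
    rw [quadVec2F]
    push_cast at hcd ⊢
    exact hcd
  have hQuad : |∑ i, Z i * Δ i| ≤ (quadL2F c w J Lc : ℝ) / SC * ‖Δ‖ := abs_sum_mul_le_sqrtHi Z Δ (fun i => quadVec2F c w J Lc i) hZb
  -- third-order remainders
  have hRem : |∑ b ∈ Lc.toFinset, (βb b * 0 + (betaLJ ‖cb b‖ * ⟪cb b, Δ⟫ - βb b * ⟪pc b, Δ⟫ -
      (αb b * ⟪pc b, cb b - pc b⟫ * ⟪pc b, Δ⟫ + βb b * ⟪cb b - pc b, Δ⟫) -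
      ((ab1 b * ⟪pc b, cb b - pc b⟫ ^ 2 + αb b * ‖cb b - pc b‖ ^ 2) * ⟪pc b, Δ⟫ + 2 * αb b * ⟪pc b, cb b - pc b⟫ * ⟪cb b - pc b, Δ⟫) / 2))| ≤
      (rem3LJ c w' Lc : ℝ) / SC * ‖Δ‖ := by
    refine (Finset.abs_sum_le_sum_abs _ _).trans ?_
    have h1 : ∑ b ∈ Lc.toFinset, |βb b * 0 + (betaLJ ‖cb b‖ * ⟪cb b, Δ⟫ - βb b * ⟪pc b, Δ⟫ -
        (αb b * ⟪pc b, cb b - pc b⟫ * ⟪pc b, Δ⟫ + βb b * ⟪cb b - pc b, Δ⟫) -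
        ((ab1 b * ⟪pc b, cb b - pc b⟫ ^ 2 + αb b * ‖cb b - pc b‖ ^ 2) * ⟪pc b, Δ⟫ + 2 * αb b * ⟪pc b, cb b - pc b⟫ * ⟪cb b - pc b, Δ⟫) / 2)| ≤
        ∑ b ∈ Lc.toFinset, ((KSl3 c w' b : ℤ) : ℝ) / SC / 6 * ((nd3S c w' b : ℝ) / SC) * ‖Δ‖ :=
      Finset.sum_le_sum fun b hb => by rw [mul_zero, zero_add]; exact (hlf b (List.mem_toFinset.1 hb)).2.2.2
    refine h1.trans ?_
    rw [← Finset.sum_mul]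
    exact mul_le_mul_of_nonneg_right (rem3LJ_sum_le c w' hLc) (norm_nonneg _)
  have hCen : |∑ b ∈ Lc.toFinset, betaLJ ‖cb b‖ * ⟪cb b, Δ⟫| ≤
      ((g0LJ c Lc : ℝ) / SC + (linLJA c w J Lc : ℝ) / SC + (quadL2F c w J Lc : ℝ) / SC + (rem3LJ c w' Lc : ℝ) / SC) * ‖Δ‖ := by
    have hsplit : ∑ b ∈ Lc.toFinset, betaLJ ‖cb b‖ * ⟪cb b, Δ⟫ =
        ∑ b ∈ Lc.toFinset, βb b * ⟪pc b, Δ⟫ +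
        ∑ b ∈ Lc.toFinset, (αb b * ⟪pc b, cb b - pc b⟫ * ⟪pc b, Δ⟫ + βb b * ⟪cb b - pc b, Δ⟫) +
        ∑ b ∈ Lc.toFinset, ((ab1 b * ⟪pc b, cb b - pc b⟫ ^ 2 + αb b * ‖cb b - pc b‖ ^ 2) * ⟪pc b, Δ⟫ +
          2 * αb b * ⟪pc b, cb b - pc b⟫ * ⟪cb b - pc b, Δ⟫) / 2 +
        ∑ b ∈ Lc.toFinset, (βb b * 0 + (betaLJ ‖cb b‖ * ⟪cb b, Δ⟫ - βb b * ⟪pc b, Δ⟫ -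
          (αb b * ⟪pc b, cb b - pc b⟫ * ⟪pc b, Δ⟫ + βb b * ⟪cb b - pc b, Δ⟫) -
          ((ab1 b * ⟪pc b, cb b - pc b⟫ ^ 2 + αb b * ‖cb b - pc b‖ ^ 2) * ⟪pc b, Δ⟫ + 2 * αb b * ⟪pc b, cb b - pc b⟫ * ⟪cb b - pc b, Δ⟫) / 2)) := by
      rw [← Finset.sum_add_distrib, ← Finset.sum_add_distrib, ← Finset.sum_add_distrib]
      exact Finset.sum_congr rfl fun b _ => by ring
    rw [hsplit, hlin_eq, hquad_eq]
    have h4 := abs_add_le (∑ b ∈ Lc.toFinset, βb b * ⟪pc b, Δ⟫ + ∑ i, X i * Δ i + ∑ i, Z i * Δ i)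
      (∑ b ∈ Lc.toFinset, (βb b * 0 + (betaLJ ‖cb b‖ * ⟪cb b, Δ⟫ - βb b * ⟪pc b, Δ⟫ -
          (αb b * ⟪pc b, cb b - pc b⟫ * ⟪pc b, Δ⟫ + βb b * ⟪cb b - pc b, Δ⟫) -
          ((ab1 b * ⟪pc b, cb b - pc b⟫ ^ 2 + αb b * ‖cb b - pc b‖ ^ 2) * ⟪pc b, Δ⟫ + 2 * αb b * ⟪pc b, cb b - pc b⟫ * ⟪cb b - pc b, Δ⟫) / 2)))
    have h3 := abs_add_three (∑ b ∈ Lc.toFinset, βb b * ⟪pc b, Δ⟫) (∑ i, X i * Δ i) (∑ i, Z i * Δ i)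
    have e : ((g0LJ c Lc : ℝ) / SC + (linLJA c w J Lc : ℝ) / SC + (quadL2F c w J Lc : ℝ) / SC + (rem3LJ c w' Lc : ℝ) / SC) * ‖Δ‖ =
        (g0LJ c Lc : ℝ) / SC * ‖Δ‖ + (linLJA c w J Lc : ℝ) / SC * ‖Δ‖ + (quadL2F c w J Lc : ℝ) / SC * ‖Δ‖ + (rem3LJ c w' Lc : ℝ) / SC * ‖Δ‖ := by ring
    rw [e]
    linarith [hG0, hLin, hQuad, hRem]
  have hGs : (g0LJ c Lc : ℝ) / SC + (linLJA c w J Lc : ℝ) / SC + (quadL2F c w J Lc : ℝ) / SC + (rem3LJ c w' Lc : ℝ) / SC + (naiSLJ c w' Ln : ℝ) / SC ≤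
      (Gs : ℝ) / SC := by
    rw [← add_div, ← add_div, ← add_div, ← add_div]
    refine div_le_div_of_nonneg_right ?_ hS.le
    exact_mod_cast hsum
  have hΔ0 : 0 ≤ ‖Δ‖ := norm_nonneg _
  calc |∑ b ∈ Lc.toFinset, betaLJ ‖cb b‖ * ⟪cb b, Δ⟫ + ∑ b ∈ Ln.toFinset, betaLJ ‖cb b‖ * ⟪cb b, Δ⟫|
      ≤ |∑ b ∈ Lc.toFinset, betaLJ ‖cb b‖ * ⟪cb b, Δ⟫| + |∑ b ∈ Ln.toFinset, betaLJ ‖cb b‖ * ⟪cb b, Δ⟫| := abs_add_le _ _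
    _ ≤ ((g0LJ c Lc : ℝ) / SC + (linLJA c w J Lc : ℝ) / SC + (quadL2F c w J Lc : ℝ) / SC + (rem3LJ c w' Lc : ℝ) / SC) * ‖Δ‖ +
        (naiSLJ c w' Ln : ℝ) / SC * ‖Δ‖ := add_le_add hCen hNai
    _ = ((g0LJ c Lc : ℝ) / SC + (linLJA c w J Lc : ℝ) / SC + (quadL2F c w J Lc : ℝ) / SC + (rem3LJ c w' Lc : ℝ) / SC + (naiSLJ c w' Ln : ℝ) / SC) * ‖Δ‖ := by
        ring
    _ ≤ (Gs : ℝ) / SC * ‖Δ‖ := mul_le_mul_of_nonneg_right hGs hΔ0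

/-- ★★★ **THE REFERENCE FORCE BOUND ALONG THE AFFINE REFERENCE, SECOND-ORDER FORM, KERNEL SHAPE** — same conclusion as
`…HomSlopeLJAffine.forceLJA_ref_bound_of_check`. [folklore chaining] -/
theorem forceLJA2F_ref_bound_of_check {c w : (Fin 3 × Fin 3) ⊕ Fin 3 → ℤ} {J : Fin 3 → Fin 3 × Fin 3 → ℤ} {Lc Ln : List (Fin 3 → ℤ)} (hL : (Lc ++ Ln).Nodup)
    {Gs : ℤ} (h : slopeCheckLJA2F c w J Lc Ln Gs = true) (U : E3 →L[ℝ] E3) (hU : ‖U - 1‖ ≤ 1 / 4)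
    (hbox : ∀ ab : Fin 3 × Fin 3, |(U (EuclideanSpace.single ab.2 (1 : ℝ))) ab.1 - (c (Sum.inl ab) : ℝ) / SC| ≤ (w (Sum.inl ab) : ℝ) / SC)
    (hn₀ : ‖affShuf J c U‖ ≤ 1 / 4) (ξ : E3) :
    |∑ bb ∈ (Lc ++ Ln).toFinset, (‖latPt U hexFrame bb + U (hcpShift + affShuf J c U)‖⁻¹ ^ 8 - ‖latPt U hexFrame bb + U (hcpShift + affShuf J c U)‖⁻¹ ^ 14) *
        ⟪latPt U hexFrame bb + U (hcpShift + affShuf J c U), U (ξ - affShuf J c U)⟫| ≤ (Gs : ℝ) / SC * ‖U (ξ - affShuf J c U)‖ := by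
  have key := slopeLJA2F_bound_of_check hL h U hU hbox hn₀ ξ
  rw [Finset.sum_congr rfl fun bb _ => segG_ljProfile_zero (latPt U hexFrame bb + U (hcpShift + affShuf J c U)) (U (ξ - affShuf J c U))] at key
  exact key

end Summit.AtomisticToContinuum.Crystallization.Theorems.FrustratedLawDichotomyStrainedPatchHomSlopeLJAffine2F

end
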